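import Mathlib
import Summits.PneNP.PneNP.Theorems.OverlapGapAlgebraSolvableImpliesStableSectionPathIsWalk
import Summits.PneNP.PneNP.Theorems.OverlapGapAlgebraSolvableImpliesStableSectionEngine
import Summits.PneNP.PneNP.Theorems.OverlapGapAlgebraSearchHardWindowScanCorrelation

/-!
# Route OverlapGapAlgebra, crux `SearchHardWindow` (stmt-PneNP-2460): the scan correlation
# inequality on Bresler–Huang path tuples of random `k`-SAT

Transfer of the abstract correlation inequality `scc_count` + defect bound `scc_defect_le`
(`OverlapGapAlgebraSearchHardWindowScanCorrelation.lean`) to the path tuples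
`Ψ : Fin (k+1) → instances` of the crux `NoStableSection` (the splice path IS the systematic-scan
resampling walk with `k` sweeps, `stub_pathIsWalk` of the `SolvableImpliesStableSection` engine).

**Theorem (`scanCorrelation_paths`).** For instances `Fin m → Fin k → Fin n × Bool` (`n ≥ 1`), any
nonempty set `G` of instances of density `p = #G/#instances`, and any symmetric irreflexive
relation `Far` ("unstable pair") whose single-literal occurrences number
`Σ_{a,b} #{(Φ, ℓ) : Far(Φ, Φ[(a,b)↦ℓ])} ≤ B`, the path tuples all of whose `k(mk)+1` splice points lie
in `G` and none of whose consecutive pairs is `Far` number at least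
`#paths · p^{k(mk)+1} · exp(−(2 log(4n)/#G) · √((2n)^{mk}/(2n)) · √(k(mk)·(k·B)))`.
No union bound over the `k²m` steps: the price of the whole path is `p^{k(mk)+1}` times a
stability defect. (Cf. Huang–Sellke, arXiv:2501.06427, Lemma 3.1, for reversible ensembles.)
-/

namespace Summit.PneNP.PneNP.Theorems

set_option linter.dupNamespace false -- `Summit.PneNP.PneNP.…`: summit = sub-problem (D-0017)

open Finset
open Summit.PneNP.PneNP.Cruxes.SolvableImpliesStableSection.Sketch
open scoped Classical

/-- **The scan correlation inequality on Bresler–Huang path tuples.** See the module docstring. -/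
theorem scanCorrelation_paths (k m n : ℕ) (hn : 1 ≤ n)
    (G : Finset (Fin m → Fin k → Fin n × Bool)) (hG : G.Nonempty)
    (Far : (Fin m → Fin k → Fin n × Bool) → (Fin m → Fin k → Fin n × Bool) → Prop)
    (hsymm : ∀ Φ Φ', Far Φ Φ' → Far Φ' Φ) (hirr : ∀ Φ, ¬ Far Φ Φ) (B : ℝ)
    (hB : (∑ a : Fin m, ∑ b : Fin k,
        (((Finset.univ : Finset ((Fin m → Fin k → Fin n × Bool) × (Fin n × Bool))).filter
          fun p => Far p.1 (Function.update p.1 a (Function.update (p.1 a) b p.2))).card : ℝ))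
      ≤ B) :
    (Fintype.card (Fin (k + 1) → Fin m → Fin k → Fin n × Bool) : ℝ) *
        ((G.card : ℝ) / Fintype.card (Fin m → Fin k → Fin n × Bool)) ^ (k * (m * k) + 1) *
        Real.exp (-(2 * Real.log (2 * (2 * n)) / G.card *
          Real.sqrt ((2 * n : ℝ) ^ (m * k) / (2 * n)) *
          Real.sqrt ((k * (m * k) : ℕ) * (k * B))))
      ≤ (((univ : Finset (Fin (k + 1) → Fin m → Fin k → Fin n × Bool)).filter fun Ψ =>
          (∀ r : Fin k, ∀ q ≤ m * k,
            (fun (a : Fin m) (b : Fin k) =>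
              if (a : ℕ) * k + b < q then Ψ r.succ a b else Ψ r.castSucc a b) ∈ G) ∧
          ∀ r : Fin k, ∀ q < m * k,
            ¬ Far (fun (a : Fin m) (b : Fin k) =>
                if (a : ℕ) * k + b < q then Ψ r.succ a b else Ψ r.castSucc a b)
              (fun (a : Fin m) (b : Fin k) =>
                if (a : ℕ) * k + b < q + 1 then Ψ r.succ a b else Ψ r.castSucc a b)).card : ℝ) := by
  -- the abstract walk (opaque objects, as in `engine_count`)
  set T : ℕ := k * (m * k) with hT
  obtain ⟨σ, hσ⟩ : ∃ σ : Fin T → Fin m × Fin k,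
      ∀ t, ((σ t).1 : ℕ) = (t : ℕ) % (m * k) / k ∧ ((σ t).2 : ℕ) = (t : ℕ) % (m * k) % k := by
    have hk : 0 < k ∨ T = 0 := by
      rcases Nat.eq_zero_or_pos k with h | h
      · right; rw [hT, h, zero_mul]
      · left; exact h
    have hmk : 0 < m * k ∨ T = 0 := by
      rcases Nat.eq_zero_or_pos (m * k) with h | h
      · right; rw [hT, h, mul_zero]
      · left; exact h
    refine ⟨fun t => (⟨(t : ℕ) % (m * k) / k, ?_⟩, ⟨(t : ℕ) % (m * k) % k, ?_⟩), fun t => ⟨rfl, rfl⟩⟩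
    · rcases hmk with hmk | hT0
      · rcases hk with hk | hT0
        · exact (Nat.div_lt_iff_lt_mul hk).2 (Nat.mod_lt _ hmk)
        · exact absurd t.isLt (by omega)
      · exact absurd t.isLt (by omega)
    · rcases hk with hk | hT0
      · exact Nat.mod_lt _ hk
      · exact absurd t.isLt (by omega)
  obtain ⟨pos, hpos0, hposS⟩ : ∃ pos : (Fin m × Fin k → Fin n × Bool) → (Fin T → Fin n × Bool) → ℕ →
      (Fin m × Fin k → Fin n × Bool), (∀ v U, pos v U 0 = v) ∧
        ∀ v U (t : Fin T), pos v U ((t : ℕ) + 1) = Function.update (pos v U t) (σ t) (U t) :=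
    ⟨fun v U t => Nat.rec (motive := fun _ => Fin m × Fin k → Fin n × Bool) v
        (fun t w => if h : t < T then Function.update w (σ ⟨t, h⟩) (U ⟨t, h⟩) else w) t,
      fun _ _ => rfl, fun v U t => by simp [t.isLt]⟩
  obtain ⟨InG, hInG⟩ : ∃ InG : (Fin m × Fin k → Fin n × Bool) → Prop,
      ∀ v, InG v ↔ Function.curry v ∈ G := ⟨_, fun _ => Iff.rfl⟩
  obtain ⟨St, hSt⟩ : ∃ St : (Fin m × Fin k → Fin n × Bool) → (Fin m × Fin k → Fin n × Bool) → Prop,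
      ∀ v w, St v w ↔ ¬ Far (Function.curry v) (Function.curry w) := ⟨_, fun _ _ => Iff.rfl⟩
  have hrefl : ∀ v, St v v := fun v => (hSt v v).2 (hirr _)
  have hsymm' : ∀ v w, St v w → St w v := fun v w h =>
    (hSt w v).2 fun h' => (hSt v w).1 h (hsymm _ _ h')
  have hS : 0 < Fintype.card (Fin n × Bool) := by rw [eng_card_S]; omega
  -- cardinalities
  have hn1 : (1 : ℝ) ≤ n := by exact_mod_cast hn
  have hcS : (Fintype.card (Fin n × Bool) : ℝ) = 2 * n := by rw [eng_card_S]; push_cast; ring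
  have hcV : (Fintype.card (Fin m × Fin k → Fin n × Bool) : ℝ) = (2 * n) ^ (m * k) := by
    rw [eng_card_V]; push_cast; ring
  have hcI : (Fintype.card (Fin m → Fin k → Fin n × Bool) : ℝ) = (2 * n) ^ (m * k) := by
    rw [eng_card_Inst]; push_cast; ring
  have hcP : (Fintype.card (Fin (k + 1) → Fin m → Fin k → Fin n × Bool) : ℝ) =
      (2 * n) ^ (m * k * (k + 1)) := by rw [eng_card_paths]; push_cast; ring
  have hGcard : ((univ : Finset (Fin m × Fin k → Fin n × Bool)).filter InG).card = G.card := by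
    refine Finset.card_equiv (Equiv.curry (Fin m) (Fin k) (Fin n × Bool)) fun v => ?_
    simp only [mem_filter, mem_univ, true_and, hInG]
    rfl
  have hG' : 0 < ((univ : Finset (Fin m × Fin k → Fin n × Bool)).filter InG).card := by
    rw [hGcard]; exact Finset.card_pos.2 hG
  have hGpos : (0 : ℝ) < G.card := by exact_mod_cast Finset.card_pos.2 hG
  -- the abstract correlation inequality and the bijection with path tuples
  obtain ⟨hfib, e, he⟩ := stub_pathIsWalk k m n σ hσ pos hpos0 hposS
  have h1 := scc_count hS T σ InG St hsymm' hrefl pos hpos0 hposS hG'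
  -- good walks inject into good path tuples
  have hinj : ((univ : Finset ((Fin m × Fin k → Fin n × Bool) × (Fin T → Fin n × Bool))).filter
        fun vU => (∀ t : Fin (T + 1), InG (pos vU.1 vU.2 t)) ∧
          ∀ t : Fin T, St (pos vU.1 vU.2 t) (pos vU.1 vU.2 ((t : ℕ) + 1))).card ≤
      ((univ : Finset (Fin (k + 1) → Fin m → Fin k → Fin n × Bool)).filter fun Ψ =>
          (∀ r : Fin k, ∀ q ≤ m * k,
            (fun (a : Fin m) (b : Fin k) =>
              if (a : ℕ) * k + b < q then Ψ r.succ a b else Ψ r.castSucc a b) ∈ G) ∧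
          ∀ r : Fin k, ∀ q < m * k,
            ¬ Far (fun (a : Fin m) (b : Fin k) =>
                if (a : ℕ) * k + b < q then Ψ r.succ a b else Ψ r.castSucc a b)
              (fun (a : Fin m) (b : Fin k) =>
                if (a : ℕ) * k + b < q + 1 then Ψ r.succ a b else Ψ r.castSucc a b)).card := by
    refine Finset.card_le_card_of_injOn e.symm (fun vU hvU => ?_) e.symm.injective.injOn
    simp only [coe_filter, mem_univ, true_and, Set.mem_setOf_eq] at hvU ⊢
    obtain ⟨hgood, hstab⟩ := hvU
    have heΨ : e (e.symm vU) = vU := e.apply_symm_apply vU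
    have hP : ∀ (r : Fin k) (q : ℕ), q ≤ m * k →
        (fun (a : Fin m) (b : Fin k) =>
          if (a : ℕ) * k + b < q then (e.symm vU) r.succ a b else (e.symm vU) r.castSucc a b) =
          Function.curry (pos vU.1 vU.2 ((r : ℕ) * (m * k) + q)) := by
      intro r q hq
      funext a b
      rw [he (e.symm vU) r q hq a b, heΨ]
      rfl
    have htime : ∀ (r : Fin k) (q : ℕ), q ≤ m * k → (r : ℕ) * (m * k) + q ≤ T := by
      intro r q hq
      calc (r : ℕ) * (m * k) + q ≤ (r : ℕ) * (m * k) + m * k := by omega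
        _ = ((r : ℕ) + 1) * (m * k) := by ring
        _ ≤ k * (m * k) := Nat.mul_le_mul_right _ r.isLt
    constructor
    · intro r q hq
      rw [hP r q hq]
      exact (hInG _).1 (hgood ⟨_, Nat.lt_succ_of_le (htime r q hq)⟩)
    · intro r q hq
      rw [hP r q hq.le, hP r (q + 1) hq]
      have hlt : (r : ℕ) * (m * k) + q < T := htime r (q + 1) hq
      exact (hSt _ _).1 (hstab ⟨_, hlt⟩)
  -- the pair counts in direction `j`: at most the `Far`-occurrences
  obtain ⟨far, hfar⟩ : ∃ far : Fin m × Fin k → ℕ, ∀ j, far j =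
      ((univ : Finset ((Fin m × Fin k → Fin n × Bool) × (Fin n × Bool))).filter fun p =>
        ¬ St p.1 (Function.update p.1 j p.2)).card := ⟨_, fun _ => rfl⟩
  have hUfar : ∀ j : Fin m × Fin k,
      (((univ : Finset ((Fin m × Fin k → Fin n × Bool) × (Fin n × Bool))).filter fun p =>
        InG p.1 ∧ (InG (Function.update p.1 j p.2) ∧ ¬ St p.1 (Function.update p.1 j p.2))).card : ℝ)
        ≤ far j := fun j => by
    rw [hfar]
    exact_mod_cast Finset.card_le_card fun p hp => by
      simp only [mem_filter, mem_univ, true_and] at hp ⊢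
      exact hp.2.2
  have hfar_curry : ∀ a b, (far (a, b) : ℝ) =
      ((univ : Finset ((Fin m → Fin k → Fin n × Bool) × (Fin n × Bool))).filter
        fun p => Far p.1 (Function.update p.1 a (Function.update (p.1 a) b p.2))).card := by
    intro a b
    rw [hfar]
    congr 1
    refine Finset.card_equiv ((Equiv.curry (Fin m) (Fin k) (Fin n × Bool)).prodCongr
      (Equiv.refl _)) fun p => ?_
    simp only [mem_filter, mem_univ, true_and, hSt, not_not, Equiv.prodCongr_apply, Equiv.coe_refl,
      Prod.map_fst, Prod.map_snd, id_eq]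
    rw [show Function.curry (Function.update p.1 (a, b) p.2) =
      Function.update ((Equiv.curry (Fin m) (Fin k) (Fin n × Bool)) p.1) a
        (Function.update ((Equiv.curry (Fin m) (Fin k) (Fin n × Bool)) p.1 a) b p.2) from
      Function.curry_update p.1 (a, b) p.2]
    rfl
  have hfar_sum : (∑ j : Fin m × Fin k, (far j : ℝ)) ≤ B := by
    rw [Fintype.sum_prod_type]
    simp only [hfar_curry]
    exact hB
  have hfar_T : (∑ t : Fin T, (far (σ t) : ℝ)) ≤ k * B := by
    rw [← Finset.sum_fiberwise' univ σ (fun j => (far j : ℝ))]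
    have : ∑ j : Fin m × Fin k, ∑ _t ∈ univ.filter (fun t => σ t = j), (far j : ℝ) =
        k * ∑ j, (far j : ℝ) := by
      rw [Finset.mul_sum]
      refine Finset.sum_congr rfl fun j _ => ?_
      rw [Finset.sum_const, hfib j, nsmul_eq_mul]
    rw [this]
    exact mul_le_mul_of_nonneg_left hfar_sum (Nat.cast_nonneg k)
  -- the defect sum: `Σ_t Λ(σ t) ≤ 2 log(2N) √(V/N) √T √(kB)` (`N = #S = 2n`, `V = #instances`)
  have hlog0 : 0 ≤ Real.log (2 * (Fintype.card (Fin n × Bool) : ℝ)) :=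
    Real.log_nonneg (by rw [hcS]; linarith)
  have hΛt : ∀ t : Fin T, ∑ v ∈ univ.filter InG,
      ((((univ : Finset (Fin n × Bool)).filter fun s => InG (Function.update v (σ t) s) ∧
          ¬ St v (Function.update v (σ t) s)).card : ℝ) + 1) /
        (((univ : Finset (Fin n × Bool)).filter fun s => InG (Function.update v (σ t) s)).card : ℝ) *
        Real.log ((((univ : Finset (Fin n × Bool)).filter fun s => InG (Function.update v (σ t) s) ∧
          ¬ St v (Function.update v (σ t) s)).card : ℝ) + 1)
      ≤ 2 * Real.log (2 * (Fintype.card (Fin n × Bool) : ℝ)) *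
          Real.sqrt ((Fintype.card (Fin m × Fin k → Fin n × Bool) : ℝ) / Fintype.card (Fin n × Bool)) *
          Real.sqrt (far (σ t)) := fun t =>
    (scc_defect_le hS (σ t) InG St).trans
      (mul_le_mul_of_nonneg_left (Real.sqrt_le_sqrt (hUfar (σ t))) (by positivity))
  have hCS : ∑ t : Fin T, Real.sqrt (far (σ t)) ≤ Real.sqrt T * Real.sqrt (k * B) := by
    have h := (le_abs_self _).trans (Real.abs_le_sqrt
      (Finset.sum_mul_sq_le_sq_mul_sq (univ : Finset (Fin T)) (fun _ => (1 : ℝ))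
        (fun t => Real.sqrt (far (σ t)))))
    simp only [one_mul, one_pow, Finset.sum_const, Finset.card_univ, Fintype.card_fin,
      nsmul_eq_mul, mul_one] at h
    refine h.trans ?_
    rw [Real.sqrt_mul (Nat.cast_nonneg T)]
    refine mul_le_mul_of_nonneg_left (Real.sqrt_le_sqrt ?_) (Real.sqrt_nonneg _)
    calc ∑ t : Fin T, Real.sqrt (far (σ t)) ^ 2 = ∑ t : Fin T, (far (σ t) : ℝ) :=
          Finset.sum_congr rfl fun t _ => Real.sq_sqrt (Nat.cast_nonneg _)
      _ ≤ k * B := hfar_T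
  have hΛ : ∑ t : Fin T, ∑ v ∈ univ.filter InG,
      ((((univ : Finset (Fin n × Bool)).filter fun s => InG (Function.update v (σ t) s) ∧
          ¬ St v (Function.update v (σ t) s)).card : ℝ) + 1) /
        (((univ : Finset (Fin n × Bool)).filter fun s => InG (Function.update v (σ t) s)).card : ℝ) *
        Real.log ((((univ : Finset (Fin n × Bool)).filter fun s => InG (Function.update v (σ t) s) ∧
          ¬ St v (Function.update v (σ t) s)).card : ℝ) + 1)
      ≤ 2 * Real.log (2 * (Fintype.card (Fin n × Bool) : ℝ)) *
          Real.sqrt ((Fintype.card (Fin m × Fin k → Fin n × Bool) : ℝ) / Fintype.card (Fin n × Bool)) *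
          (Real.sqrt T * Real.sqrt (k * B)) := by
    refine (Finset.sum_le_sum fun t _ => hΛt t).trans ?_
    rw [← Finset.mul_sum]
    exact mul_le_mul_of_nonneg_left hCS (by positivity)
  -- compare the exponents
  have hexp : Real.exp (-(2 * Real.log (2 * (2 * n)) / G.card *
      Real.sqrt ((2 * n : ℝ) ^ (m * k) / (2 * n)) * Real.sqrt ((T : ℝ) * (k * B)))) ≤
      Real.exp (-((G.card : ℝ)⁻¹ *
        ∑ t : Fin T, ∑ v ∈ univ.filter InG,
          ((((univ : Finset (Fin n × Bool)).filter fun s => InG (Function.update v (σ t) s) ∧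
              ¬ St v (Function.update v (σ t) s)).card : ℝ) + 1) /
            (((univ : Finset (Fin n × Bool)).filter fun s =>
              InG (Function.update v (σ t) s)).card : ℝ) *
            Real.log ((((univ : Finset (Fin n × Bool)).filter fun s =>
              InG (Function.update v (σ t) s) ∧ ¬ St v (Function.update v (σ t) s)).card : ℝ) + 1))) := by
    rw [Real.exp_le_exp, neg_le_neg_iff]
    have hG0 : (0 : ℝ) ≤ (G.card : ℝ)⁻¹ := (inv_pos.2 hGpos).le
    refine (mul_le_mul_of_nonneg_left hΛ hG0).trans (le_of_eq ?_)
    rw [hcS, hcV, Real.sqrt_mul (Nat.cast_nonneg T) ((k : ℝ) * B)]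
    field_simp
  -- assemble
  have hinj' := (Nat.cast_le (α := ℝ)).2 hinj
  have hcount := h1.trans hinj'
  rw [hGcard, hcV, hcS] at hcount
  have hPV : (Fintype.card (Fin (k + 1) → Fin m → Fin k → Fin n × Bool) : ℝ) =
      (2 * n : ℝ) ^ (m * k) * (2 * n : ℝ) ^ T := by
    rw [hcP, ← pow_add]
    congr 1
    rw [hT]
    ring
  rw [hPV, hcI]
  exact le_trans (mul_le_mul_of_nonneg_left hexp (by positivity)) hcount

end Summit.PneNP.PneNP.Theorems
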